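import Literature.Analysis.FluidPDE.FluidComputer.ThresholdLevelTable
import HarnessLib

/-!
# Kernel run of the level-table checker, chunks 28 … 31 (steps 700 … 799) (bp3 gen 13, layer 4)

HONEST FRAMING: low prior, high value-of-information experiment on Tao's machine paradigm; NOT a
claim that NS blows up.

Four kernel evaluations (`decide +kernel`; no `native_decide`, no extra axioms): the checker
`runSteps` of `ThresholdLevelCheck.lean` (crude box, `K = 3` refinement passes, side and runtime
conditions, reach, speed, exit box — all in the dyadic interval arithmetic `DI` at `P = 60` with
`12` Taylor terms) runs 25 steps of `ThresholdLevelTable.stepsT` at a time, from the entry box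
`Bc i` towards the next chunk's first level, and returns the entry box `Bc (i+1)` (≈ 30 s of
kernel time and bounded memory per chunk; 100-step chunks exceed the kernel's memory bound).
-/

namespace Literature.Analysis.FluidPDE.FluidComputer

namespace ThresholdLevelTable

set_option maxHeartbeats 10000000 in
set_option maxRecDepth 200000 in
/-- Chunk 28 of the table run (steps 700 … 724). [folklore] -/
theorem run28 : runSteps 60 12 3 GIt RbIt Bc28 chunk28 73345994452495776 = some Bc29 := by
  decide +kernel

set_option maxHeartbeats 10000000 in
set_option maxRecDepth 200000 in
/-- Chunk 29 of the table run (steps 725 … 749). [folklore] -/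
theorem run29 : runSteps 60 12 3 GIt RbIt Bc29 chunk29 87293743852046672 = some Bc30 := by
  decide +kernel

set_option maxHeartbeats 10000000 in
set_option maxRecDepth 200000 in
/-- Chunk 30 of the table run (steps 750 … 774). [folklore] -/
theorem run30 : runSteps 60 12 3 GIt RbIt Bc30 chunk30 103893849590411248 = some Bc31 := by
  decide +kernel

set_option maxHeartbeats 10000000 in
set_option maxRecDepth 200000 in
/-- Chunk 31 of the table run (steps 775 … 799). [folklore] -/
theorem run31 : runSteps 60 12 3 GIt RbIt Bc31 chunk31 123650693697013712 = some Bc32 := by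
  decide +kernel

end ThresholdLevelTable

end Literature.Analysis.FluidPDE.FluidComputer
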